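import Literature.AlgebraicGeometry.Motives.EllAdicTowerRational
import Literature.AlgebraicGeometry.Motives.EtaleModCohomologyPoint
import Literature.AlgebraicGeometry.Motives.ZModPowTowerLim
import HarnessLib

/-!
# `H⁰` of a geometric point: `lim_m H⁰((Spec K)_ét, ℤ/ℓᵐ) = ℤ_ℓ` and `H⁰((Spec K)_ét, ℚ_ℓ) = ℚ_ℓ`

For `K` separably closed, `EtaleModCohomologyPoint.lean` identifies `H⁰((Spec K)_ét, R)` with `R`
(`etaleModCohomologyZeroPointAddEquiv`, `1 ↦ 1`). Here this is promoted to the `ℓ`-adic theory: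

* `etaleModCohomologyZeroPointAddEquiv_cup`: the identification is **multiplicative** for the cup
  product (in degree `0` the cup product is composition of endomorphisms of the constant sheaf);
* `levelZeroPointAddEquiv_zmodPowReduction`: hence it commutes with the reductions `ρ_m : H⁰(ℤ/ℓᵐ⁺¹) → H⁰(ℤ/ℓᵐ)`
  of the tower — both sides are ring homomorphisms `ℤ/ℓᵐ⁺¹ → ℤ/ℓᵐ`, and there is only one
  (Mathlib `RingHom.ext_zmod`);
* `etaleEllAdicTowerCohomologyZeroPointEquiv : lim_m H⁰((Spec K)_ét, ℤ/ℓᵐ) ≃ₗ[ℤ_ℓ] ℤ_ℓ`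
  (`ZModPowTowerLim.lean`: `lim ℤ/ℓᵐ = ℤ_ℓ`), unit to unit;
* `etaleEllAdicRatZeroPointEquiv : H⁰((Spec K)_ét, ℚ_ℓ) ≃ₗ[ℚ_ℓ] ℚ_ℓ`, unit to unit — the value on
  a point (`X = Spec k`, `X_{k̄} = Spec k̄`) of a Weil cohomology: `H⁰(pt) = K`
  (Kleiman 1968 §1.2; Milne III Example 1.7 (a), V §1).

## References

* J. S. Milne, *Étale cohomology* (reissue 2025; `book:milne2025-etale-cohomology`): III
  Example 1.7 (a) (PDF p. 95), V §1 (p. 176). [Milne2025]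
-/

universe u

open CategoryTheory CategoryTheory.Limits AlgebraicGeometry Opposite CategoryTheory.Abelian
open scoped TensorProduct

namespace Literature.AlgebraicGeometry.Motives

set_option synthInstance.maxHeartbeats 400000
set_option maxHeartbeats 1600000

/-! ### The identification `H⁰((Spec K)_ét, R) = R` is multiplicative -/

section Ring

variable (K : Type u) [Field K] [IsSepClosed K] (R : Type u) [CommRing R]

/-- The value of `H⁰((Spec K)_ét, R) ≃ R` on the class of an endomorphism `φ` of the constant sheaf:
the scalar by which the corresponding endomorphism of `R` (constant sheaves are fully faithful on
the local site `(Spec K)_et`) acts on `1`. [folklore] -/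
theorem etaleModCohomologyZeroPointAddEquiv_mk₀
    (φ : constantSheafSelf (Spec (CommRingCat.of K)).smallEtaleTopology R ⟶
      constantSheafSelf (Spec (CommRingCat.of K)).smallEtaleTopology R) :
    etaleModCohomologyZeroPointAddEquiv K R (Ext.mk₀ φ) =
      ((Functor.FullyFaithful.ofFullyFaithful
        (constantSheaf (Spec (CommRingCat.of K)).smallEtaleTopology (ModuleCat.{u} R))).preimage
          φ).hom (1 : R) := by
  have h0 : Ext.addEquiv₀ (Ext.mk₀ φ) = φ :=
    (Ext.mk₀_bijective _ _).1 (by rw [Ext.mk₀_addEquiv₀_apply])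
  change LinearMap.ringLmapEquivSelf R R R (ModuleCat.homAddEquiv
    (endConstantSheafSelfPointAddEquiv K R (Ext.addEquiv₀ (Ext.mk₀ φ)))) = _
  rw [h0]
  rfl

/-- **`H⁰((Spec K)_ét, R) ≃ R` is multiplicative**: `e(x ∪ y) = e(x) e(y)` (in degree `0` the cup
product is the composition of endomorphisms of `R_{Spec K}`, i.e. of `R`). [folklore] -/
theorem etaleModCohomologyZeroPointAddEquiv_cup
    (x y : etaleModCohomology (Spec (CommRingCat.of K)) R 0) :
    etaleModCohomologyZeroPointAddEquiv K R (linearCohomology.cup (add_zero 0) x y) =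
      etaleModCohomologyZeroPointAddEquiv K R x * etaleModCohomologyZeroPointAddEquiv K R y := by
  obtain ⟨f, rfl⟩ := (Ext.mk₀_bijective _ _).2 x
  obtain ⟨g, rfl⟩ := (Ext.mk₀_bijective _ _).2 y
  rw [linearCohomology.cup_apply, Ext.mk₀_comp_mk₀, etaleModCohomologyZeroPointAddEquiv_mk₀,
    etaleModCohomologyZeroPointAddEquiv_mk₀, etaleModCohomologyZeroPointAddEquiv_mk₀,
    Functor.FullyFaithful.preimage_comp, ModuleCat.hom_comp, LinearMap.comp_apply]
  set a := ((Functor.FullyFaithful.ofFullyFaithful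
    (constantSheaf (Spec (CommRingCat.of K)).smallEtaleTopology (ModuleCat.{u} R))).preimage f).hom
      (1 : R)
  set G := ((Functor.FullyFaithful.ofFullyFaithful
    (constantSheaf (Spec (CommRingCat.of K)).smallEtaleTopology (ModuleCat.{u} R))).preimage g).hom
  calc G a = G (a • (1 : R)) := by rw [smul_eq_mul, mul_one]
    _ = a • G 1 := G.map_smul a 1
    _ = a * G 1 := smul_eq_mul _ _

end Ring

/-! ### The reductions of the tower at a geometric point are the reductions `ℤ/ℓᵐ⁺¹ → ℤ/ℓᵐ` -/

section Level

variable (K : Type u) [Field K] [IsSepClosed K] (ℓ : ℕ) [Fact ℓ.Prime]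

/-- The isomorphism `H⁰((Spec K)_ét, ℤ/ℓᵐ) ≃ ℤ/ℓᵐ` at level `m` of the tower. [folklore] -/
noncomputable abbrev levelZeroPointAddEquiv (m : ℕ) :
    etaleZModPowCohomology (Spec (CommRingCat.of K)) ℓ m 0 ≃+ ZModPow.{u} ℓ m :=
  etaleModCohomologyZeroPointAddEquiv K (ZModPow.{u} ℓ m)

/-- The reduction `ρ_m` of the tower, transported to `ℤ/ℓᵐ⁺¹ → ℤ/ℓᵐ`: a ring homomorphism (`ρ_m`
is multiplicative and unital, `zmodPowReduction_cup/_one`, and the identifications are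
multiplicative and unital). [folklore] -/
noncomputable def levelReductionHom (m : ℕ) : ZModPow.{u} ℓ (m + 1) →+* ZModPow.{u} ℓ m where
  toFun s := levelZeroPointAddEquiv K ℓ m
    (zmodPowReduction (isTerminalEtaleMkId (Spec (.of K))) ℓ m 0
      ((levelZeroPointAddEquiv K ℓ (m + 1)).symm s))
  map_one' := by
    have h1 : (levelZeroPointAddEquiv K ℓ (m + 1)).symm 1 =
        linearCohomology.one (Spec (CommRingCat.of K)).smallEtaleTopology (ZModPow.{u} ℓ (m + 1)) :=
      (AddEquiv.symm_apply_eq _).2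
        (etaleModCohomologyZeroPointAddEquiv_one K (ZModPow.{u} ℓ (m + 1))).symm
    rw [h1, zmodPowReduction_one]
    exact etaleModCohomologyZeroPointAddEquiv_one K (ZModPow.{u} ℓ m)
  map_mul' s t := by
    have hs : ∀ s t : ZModPow.{u} ℓ (m + 1), (levelZeroPointAddEquiv K ℓ (m + 1)).symm (s * t) =
        linearCohomology.cup (add_zero 0) ((levelZeroPointAddEquiv K ℓ (m + 1)).symm s)
          ((levelZeroPointAddEquiv K ℓ (m + 1)).symm t) := fun s t =>
      (AddEquiv.symm_apply_eq _).2 (by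
        rw [etaleModCohomologyZeroPointAddEquiv_cup, AddEquiv.apply_symm_apply,
          AddEquiv.apply_symm_apply])
    change levelZeroPointAddEquiv K ℓ m (zmodPowReduction _ ℓ m 0 _) = _
    rw [hs, zmodPowReduction_cup]
    exact etaleModCohomologyZeroPointAddEquiv_cup K (ZModPow.{u} ℓ m) _ _
  map_zero' := by
    rw [map_zero, map_zero, map_zero]
  map_add' s t := by
    rw [map_add, map_add, map_add]

/-- **There is only one ring homomorphism `ℤ/ℓᵐ⁺¹ → ℤ/ℓᵐ`**, so the transported reduction is the
canonical one (Mathlib `RingHom.ext_zmod`). [folklore] -/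
theorem levelReductionHom_eq (m : ℕ) : levelReductionHom K ℓ m = zmodPowRed.{u} ℓ m := by
  have h : (levelReductionHom K ℓ m).comp ULift.ringEquiv.{0, u}.symm.toRingHom =
      (zmodPowRed.{u} ℓ m).comp ULift.ringEquiv.{0, u}.symm.toRingHom :=
    RingHom.ext_zmod _ _
  refine RingHom.ext fun s => ?_
  have hs : ULift.ringEquiv.{0, u}.symm s.down = s := rfl
  rw [← hs]
  exact RingHom.congr_fun h s.down

/-- **The reductions of the `ℓ`-adic tower at a geometric point are the reductions
`ℤ/ℓᵐ⁺¹ → ℤ/ℓᵐ`** under `H⁰((Spec K)_ét, ℤ/ℓ•) ≃ ℤ/ℓ•`. [folklore] -/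
theorem levelZeroPointAddEquiv_zmodPowReduction (m : ℕ)
    (x : etaleZModPowCohomology (Spec (CommRingCat.of K)) ℓ (m + 1) 0) :
    levelZeroPointAddEquiv K ℓ m (zmodPowReduction (isTerminalEtaleMkId (Spec (.of K))) ℓ m 0 x) =
      zmodPowRed.{u} ℓ m (levelZeroPointAddEquiv K ℓ (m + 1) x) := by
  have h := RingHom.congr_fun (levelReductionHom_eq K ℓ m) (levelZeroPointAddEquiv K ℓ (m + 1) x)
  rw [← h]
  change _ = levelZeroPointAddEquiv K ℓ m (zmodPowReduction _ ℓ m 0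
    ((levelZeroPointAddEquiv K ℓ (m + 1)).symm (levelZeroPointAddEquiv K ℓ (m + 1) x)))
  rw [AddEquiv.symm_apply_apply]

end Level

/-! ### `lim_m H⁰((Spec K)_ét, ℤ/ℓᵐ) = ℤ_ℓ` -/

section Tower

variable (K : Type u) [Field K] [IsSepClosed K] (ℓ : ℕ) [Fact ℓ.Prime]

/-- **`lim_m H⁰((Spec K)_ét, ℤ/ℓᵐ) ≃ lim_m ℤ/ℓᵐ`**, `ℤ_ℓ`-linear, levelwise `H⁰(ℤ/ℓᵐ) ≃ ℤ/ℓᵐ`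
(compatible with the reductions by `levelZeroPointAddEquiv_zmodPowReduction`). [folklore] -/
noncomputable def etaleEllAdicTowerCohomologyZeroPointEquivTowerLim :
    etaleEllAdicTowerCohomology (Spec (CommRingCat.of K)) ℓ 0 ≃ₗ[ℤ_[ℓ]]
      towerLim (zmodPowTower.{u} ℓ) :=
  { towerLim.mapLinear ℓ (fun m => (levelZeroPointAddEquiv K ℓ m).toAddMonoidHom)
      (fun m x => levelZeroPointAddEquiv_zmodPowReduction K ℓ m x) with
    invFun := towerLim.map (fun m => (levelZeroPointAddEquiv K ℓ m).symm.toAddMonoidHom)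
      (fun m s => by
        apply (levelZeroPointAddEquiv K ℓ m).injective
        change levelZeroPointAddEquiv K ℓ m ((levelZeroPointAddEquiv K ℓ m).symm _) =
          levelZeroPointAddEquiv K ℓ m (zmodPowReduction _ ℓ m 0
            ((levelZeroPointAddEquiv K ℓ (m + 1)).symm s))
        rw [AddEquiv.apply_symm_apply, levelZeroPointAddEquiv_zmodPowReduction,
          AddEquiv.apply_symm_apply]
        rfl)
    left_inv := fun x => Subtype.ext <| funext fun m =>
      (levelZeroPointAddEquiv K ℓ m).symm_apply_apply _
    right_inv := fun a => Subtype.ext <| funext fun m =>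
      (levelZeroPointAddEquiv K ℓ m).apply_symm_apply _ }

/-- Components: `(e x)_m = e_m(x_m)`. [folklore] -/
theorem coe_etaleEllAdicTowerCohomologyZeroPointEquivTowerLim_apply
    (x : etaleEllAdicTowerCohomology (Spec (CommRingCat.of K)) ℓ 0) (m : ℕ) :
    (etaleEllAdicTowerCohomologyZeroPointEquivTowerLim K ℓ x : ∀ m, ZModPow.{u} ℓ m) m =
      levelZeroPointAddEquiv K ℓ m
        ((x : ∀ m, etaleZModPowCohomology (Spec (CommRingCat.of K)) ℓ m 0) m) :=
  rfl

/-- **`lim_m H⁰((Spec K)_ét, ℤ/ℓᵐ) ≃ ℤ_ℓ`** as `ℤ_ℓ`-modules (`K` separably closed): the `ℓ`-adic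
cohomology of a geometric point in degree `0` (Milne V §1: `H⁰(X, ℤ_l) = lim H⁰(X, ℤ/lⁿ)`, here
`= lim ℤ/lⁿ = ℤ_l`). [cite: Milne2025, V §1 (p. 176)] -/
noncomputable def etaleEllAdicTowerCohomologyZeroPointEquiv :
    etaleEllAdicTowerCohomology (Spec (CommRingCat.of K)) ℓ 0 ≃ₗ[ℤ_[ℓ]] ℤ_[ℓ] :=
  (etaleEllAdicTowerCohomologyZeroPointEquivTowerLim K ℓ).trans
    (padicIntEquivZModPowTowerLim.{u} ℓ).symm

/-- The unit `1 ∈ lim_m H⁰((Spec K)_ét, ℤ/ℓᵐ)` goes to `1 ∈ ℤ_ℓ`. [folklore] -/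
theorem etaleEllAdicTowerCohomologyZeroPointEquiv_one :
    etaleEllAdicTowerCohomologyZeroPointEquiv K ℓ
        (ellAdicTowerCohomology.one (isTerminalEtaleMkId (Spec (.of K))) ℓ) = 1 := by
  change (padicIntEquivZModPowTowerLim.{u} ℓ).symm
    (etaleEllAdicTowerCohomologyZeroPointEquivTowerLim K ℓ
      (ellAdicTowerCohomology.one (isTerminalEtaleMkId (Spec (.of K))) ℓ)) = 1
  rw [LinearEquiv.symm_apply_eq]
  refine Subtype.ext (funext fun m => ?_)
  rw [coe_etaleEllAdicTowerCohomologyZeroPointEquivTowerLim_apply,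
    ellAdicTowerCohomology.coe_one, coe_padicIntEquivZModPowTowerLim_one]
  exact etaleModCohomologyZeroPointAddEquiv_one K (ZModPow.{u} ℓ m)

end Tower

/-! ### `H⁰((Spec K)_ét, ℚ_ℓ) = ℚ_ℓ` -/

section Rat

variable (K : Type u) [Field K] [IsSepClosed K] (ℓ : ℕ) [Fact ℓ.Prime]

/-- **`H⁰((Spec K)_ét, ℚ_ℓ) ≃ ℚ_ℓ`** (`K` separably closed): `ℚ_ℓ ⊗_{ℤ_ℓ} lim_m H⁰(ℤ/ℓᵐ) ≃ ℚ_ℓ ⊗ ℤ_ℓ ≃ ℚ_ℓ`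
— `H⁰(pt) = K` for the coefficient field `K = ℚ_ℓ` of the `ℓ`-adic Weil cohomology.
[cite: Milne2025, III Example 1.7 (a)] -/
noncomputable def etaleEllAdicRatZeroPointEquiv :
    etaleEllAdicRat ℓ (Spec (CommRingCat.of K)) 0 ≃ₗ[ℚ_[ℓ]] ℚ_[ℓ] :=
  ((etaleEllAdicTowerCohomologyZeroPointEquiv K ℓ).baseChange ℤ_[ℓ] ℚ_[ℓ] _ _).trans
    (TensorProduct.AlgebraTensorModule.rid ℤ_[ℓ] ℚ_[ℓ] ℚ_[ℓ])

/-- The unit `1 ∈ H⁰((Spec K)_ét, ℚ_ℓ)` goes to `1 ∈ ℚ_ℓ`. [folklore] -/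
theorem etaleEllAdicRatZeroPointEquiv_one :
    etaleEllAdicRatZeroPointEquiv K ℓ (etaleEllAdicRat.one ℓ (Spec (CommRingCat.of K))) = 1 := by
  change TensorProduct.AlgebraTensorModule.rid ℤ_[ℓ] ℚ_[ℓ] ℚ_[ℓ]
    (((etaleEllAdicTowerCohomologyZeroPointEquiv K ℓ).baseChange ℤ_[ℓ] ℚ_[ℓ] _ _)
      ((1 : ℚ_[ℓ]) ⊗ₜ ellAdicTowerCohomology.one (isTerminalEtaleMkId (Spec (.of K))) ℓ)) = 1
  rw [LinearEquiv.baseChange_tmul, etaleEllAdicTowerCohomologyZeroPointEquiv_one,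
    TensorProduct.AlgebraTensorModule.rid_tmul, one_smul]

end Rat

end Literature.AlgebraicGeometry.Motives
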